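import Mathlib
import HarnessLib
import Summits.CriticalPhenomena.Ising3DConformalLimit.Theorems.ModularBoostsLimitRotationInvarianceGaussian
import Summits.CriticalPhenomena.Ising3DConformalLimit.Theorems.HyperoctahedralRPLimitRotationInvariantFourfoldToFull
import Summits.CriticalPhenomena.Ising3DConformalLimit.Theorems.HyperoctahedralRPLimitRotationInvariantLimitRegularity
import Summits.CriticalPhenomena.Ising3DConformalLimit.Theorems.HyperoctahedralRPLimitRotationInvariantNineMirrorRP

/-!
# `LimitRotationInvariance` (route ModularBoosts, milestone item stmt-CriticalPhenomena-5434):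
# the milestone is invariance under the rotations about ONE lattice axis, at axis-generic configurations

The milestone `ModularBoosts.LimitRotationInvariance` — every normalised, non-degenerate,
translation-invariant, scale-covariant pointwise scaling limit `S` of the critical nearest-neighbour
Ising correlators on `ℤ³` is `O(3)`-invariant at every level `n` — is rotation invariance of the
critical `ℤ³` Ising scaling limit (open: H. Duminil-Copin, ICM 2022, §8.1), equivalent to the crux
`HyperoctahedralRP.LimitRotationInvariant` (`limitRotationInvariance_iff_hyperoctahedral`).  The tree
settles the levels `n ≤ 2`, the odd levels and the Gaussian case
(`limitRotationInvariance_iff_hasNontrivialU4_even_four_le`).  This file removes the GROUP and the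
CONFIGURATION from what is open, using three landed stubs of the line `quarter-turn-liouville` of that
crux (`stub_limitRegularity`, `stub_nineMirrorRP`, `stub_fourfoldToFull`):

* `limitStructure_of_hyp`: every such limit has the line's `LimitStructure` (window, symmetries,
  Gaussian domination, continuity off the diagonals, nine-mirror reflection positivity);
* `rotInvAt_of_rot_axisGeneric`: at a fixed level `n`, invariance of `S n` under the rotations
  `rot θ = planeRot 0 θ` about the lattice axis `e₂` at the AXIS-GENERIC configurations alone already
  gives invariance under every linear isometry of `ℝ³` at level `n` (density + continuity +
  hyperoctahedral conjugation + Cartan–Dieudonné, `stub_fourfoldToFull`);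
* `limitRotationInvariance_iff_rot_axisGeneric`, `limitRotationInvariance_iff_rot`: hence the milestone
  is EQUIVALENT to invariance of every such limit under the one-parameter group of rotations about `e₂`
  (at axis-generic configurations, resp. everywhere);
* `limitRotationInvariance_iff_core`: combined with the level and Gaussian reductions, what is open is
  exactly: for interacting limits (`HasNontrivialU4 S`), at even levels `n ≥ 4` and axis-generic
  configurations, `S n (rot θ ∘ x) = S n x` for all real `θ` — one real parameter, one lattice axis.

References: H. Duminil-Copin, *100 years of the (critical) Ising model on the hypercubic lattice*,
Proc. ICM 2022, §8.1; É. Cartan, *Leçons sur la théorie des spineurs* (1938) / J. Dieudonné, *Sur les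
groupes classiques* (1948) (generation of `O(3)` by reflections); S. Friedli, Y. Velenik, *Statistical
Mechanics of Lattice Systems* (CUP 2017), Exercise 3.14 (lattice symmetries). No definitions are
introduced (vocabulary `rot`, `AxisGeneric`, `RotInvAt`, `LimitStructure`, `CruxHyp` from
`…Theorems.HyperoctahedralRPLimitRotationInvariantQuarterTurnDefs`).
-/

noncomputable section

namespace Summit.CriticalPhenomena.Ising3DConformalLimit.ModularBoostsRotation

open Literature.Probability.LatticeModels
open Summit.CriticalPhenomena.Ising3DConformalLimit.Theses
open Summit.CriticalPhenomena.Ising3DConformalLimit.Theses.ModularBoosts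
open Summit.CriticalPhenomena.Ising3DConformalLimit.Cruxes.LimitRotationInvariant.QuarterTurnLiouville

variable {ρ : ℝ → ℝ} {Δ : ℝ} {S : CorrFamily 3}

/-! ### Every limit has the line's `LimitStructure` -/

/-- **`LimitStructure` of a limit.** A normalised, non-degenerate, translation-invariant,
scale-covariant pointwise scaling limit `S` of `criticalCorr 3` (scaling `ρ > 0` on `(0,1]`, exponent
`Δ`) has the structure `LimitStructure Δ S`: the window `1/2 ≤ Δ ≤ 1`, hyperoctahedral invariance,
permutation symmetry, Gaussian domination, continuity on `NonCoincident` (`stub_limitRegularity`) and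
reflection positivity in the nine lattice mirrors (`stub_nineMirrorRP`).
[cite: FriedliVelenik2017, Exercise 3.14, p. 115] -/
theorem limitStructure_of_hyp (hρ : ∀ δ ∈ Set.Ioc (0:ℝ) 1, 0 < ρ δ)
    (hlim : HasPointwiseScalingLimit (criticalCorr 3) ρ S)
    (hnorm : ∀ n z, z ∉ NonCoincident 3 n → S n z = 0) (hnd : IsNondegenerateTwoPoint S)
    (htr : IsTranslationInvariant S) (hsc : IsScaleCovariant Δ S) : LimitStructure Δ S :=
  ⟨stub_limitRegularity ρ Δ S ⟨hρ, hlim, hnorm, hnd, htr, hsc⟩,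
    stub_nineMirrorRP ρ Δ S ⟨hρ, hlim, hnorm, hnd, htr, hsc⟩⟩

/-! ### One axis, generic configurations ⇒ `O(3)`, level by level -/

/-- **Axis-generic `e₂`-invariance at level `n` gives `O(3)` invariance at level `n`.** For a limit `S`
as above and a level `n`: if `S n (rot θ ∘ x) = S n x` for every real `θ` and every AXIS-GENERIC
configuration `x` (`rot θ` the rotation about the lattice axis `e₂`), then `S n (R ∘ x) = S n x` for
every linear isometry `R` of `ℝ³` and every configuration `x` (`stub_fourfoldToFull` of the crux line:
density of `AxisGeneric`, continuity of `S n` on `NonCoincident`, conjugation by the point group `O_h`,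
Cartan–Dieudonné). [cite: DuminilCopinICM2022, §8.1] -/
theorem rotInvAt_of_rot_axisGeneric (hρ : ∀ δ ∈ Set.Ioc (0:ℝ) 1, 0 < ρ δ)
    (hlim : HasPointwiseScalingLimit (criticalCorr 3) ρ S)
    (hnorm : ∀ n z, z ∉ NonCoincident 3 n → S n z = 0) (hnd : IsNondegenerateTwoPoint S)
    (htr : IsTranslationInvariant S) (hsc : IsScaleCovariant Δ S) (n : ℕ)
    (hgen : ∀ x : Fin n → EuclideanSpace ℝ (Fin 3), AxisGeneric x →
      ∀ θ : ℝ, S n (fun i => rot θ (x i)) = S n x) :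
    RotInvAt S n :=
  stub_fourfoldToFull Δ S (limitStructure_of_hyp hρ hlim hnorm hnd htr hsc) n hgen

/-- The same with `e₂`-invariance assumed at every configuration of level `n`.
[cite: DuminilCopinICM2022, §8.1] -/
theorem rotInvAt_of_rot (hρ : ∀ δ ∈ Set.Ioc (0:ℝ) 1, 0 < ρ δ)
    (hlim : HasPointwiseScalingLimit (criticalCorr 3) ρ S)
    (hnorm : ∀ n z, z ∉ NonCoincident 3 n → S n z = 0) (hnd : IsNondegenerateTwoPoint S)
    (htr : IsTranslationInvariant S) (hsc : IsScaleCovariant Δ S) (n : ℕ)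
    (hrot : ∀ (θ : ℝ) (x : Fin n → EuclideanSpace ℝ (Fin 3)), S n (fun i => rot θ (x i)) = S n x) :
    RotInvAt S n :=
  rotInvAt_of_rot_axisGeneric hρ hlim hnorm hnd htr hsc n fun x _ θ => hrot θ x

/-! ### The milestone is `e₂`-rotation invariance -/

/-- **`LimitRotationInvariance` ⇔ invariance under the rotations about one lattice axis at axis-generic
configurations.** The milestone holds if and only if every normalised, non-degenerate,
translation-invariant, scale-covariant pointwise limit `S` of `criticalCorr 3` satisfies
`S n (rot θ ∘ x) = S n x` for all levels `n`, all real angles `θ` and all axis-generic configurations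
`x` (`rot θ = planeRot 0 θ`, the rotation about `e₂`): the full orthogonal group and the non-generic
configurations come for free (`rotInvAt_of_rot_axisGeneric`). [cite: DuminilCopinICM2022, §8.1] -/
theorem limitRotationInvariance_iff_rot_axisGeneric :
    LimitRotationInvariance ↔
      ∀ (ρ : ℝ → ℝ) (Δ : ℝ) (S : CorrFamily 3), (∀ δ ∈ Set.Ioc (0:ℝ) 1, 0 < ρ δ) →
        HasPointwiseScalingLimit (criticalCorr 3) ρ S →
        (∀ n z, z ∉ NonCoincident 3 n → S n z = 0) → IsNondegenerateTwoPoint S →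
        IsTranslationInvariant S → IsScaleCovariant Δ S →
        ∀ (n : ℕ) (x : Fin n → EuclideanSpace ℝ (Fin 3)), AxisGeneric x →
          ∀ θ : ℝ, S n (fun i => rot θ (x i)) = S n x := by
  constructor
  · intro h ρ Δ S hρ hlim hnorm hnd htr hsc n x _ θ
    exact h ρ Δ S hρ hlim hnorm hnd htr hsc n (rot θ) x
  · intro h ρ Δ S hρ hlim hnorm hnd htr hsc n R x
    exact rotInvAt_of_rot_axisGeneric hρ hlim hnorm hnd htr hsc n
      (fun y hy θ => h ρ Δ S hρ hlim hnorm hnd htr hsc n y hy θ) R x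

/-- **`LimitRotationInvariance` ⇔ invariance under the rotations about one lattice axis** (all
configurations). [cite: DuminilCopinICM2022, §8.1] -/
theorem limitRotationInvariance_iff_rot :
    LimitRotationInvariance ↔
      ∀ (ρ : ℝ → ℝ) (Δ : ℝ) (S : CorrFamily 3), (∀ δ ∈ Set.Ioc (0:ℝ) 1, 0 < ρ δ) →
        HasPointwiseScalingLimit (criticalCorr 3) ρ S →
        (∀ n z, z ∉ NonCoincident 3 n → S n z = 0) → IsNondegenerateTwoPoint S →
        IsTranslationInvariant S → IsScaleCovariant Δ S →
        ∀ (n : ℕ) (θ : ℝ) (x : Fin n → EuclideanSpace ℝ (Fin 3)),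
          S n (fun i => rot θ (x i)) = S n x := by
  constructor
  · intro h ρ Δ S hρ hlim hnorm hnd htr hsc n θ x
    exact h ρ Δ S hρ hlim hnorm hnd htr hsc n (rot θ) x
  · intro h ρ Δ S hρ hlim hnorm hnd htr hsc n R x
    exact rotInvAt_of_rot hρ hlim hnorm hnd htr hsc n (h ρ Δ S hρ hlim hnorm hnd htr hsc n) R x

/-- Hence the milestone follows from `e₂`-rotation invariance of every such limit (all levels, all
configurations). [cite: DuminilCopinICM2022, §8.1] -/
theorem limitRotationInvariance_of_rot
    (h : ∀ (ρ : ℝ → ℝ) (Δ : ℝ) (S : CorrFamily 3), (∀ δ ∈ Set.Ioc (0:ℝ) 1, 0 < ρ δ) →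
        HasPointwiseScalingLimit (criticalCorr 3) ρ S →
        (∀ n z, z ∉ NonCoincident 3 n → S n z = 0) → IsNondegenerateTwoPoint S →
        IsTranslationInvariant S → IsScaleCovariant Δ S →
        ∀ (n : ℕ) (θ : ℝ) (x : Fin n → EuclideanSpace ℝ (Fin 3)),
          S n (fun i => rot θ (x i)) = S n x) :
    LimitRotationInvariance :=
  limitRotationInvariance_iff_rot.2 h

/-- Hence the milestone follows from `e₂`-rotation invariance of every such limit at axis-generic
configurations. [cite: DuminilCopinICM2022, §8.1] -/
theorem limitRotationInvariance_of_rot_axisGeneric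
    (h : ∀ (ρ : ℝ → ℝ) (Δ : ℝ) (S : CorrFamily 3), (∀ δ ∈ Set.Ioc (0:ℝ) 1, 0 < ρ δ) →
        HasPointwiseScalingLimit (criticalCorr 3) ρ S →
        (∀ n z, z ∉ NonCoincident 3 n → S n z = 0) → IsNondegenerateTwoPoint S →
        IsTranslationInvariant S → IsScaleCovariant Δ S →
        ∀ (n : ℕ) (x : Fin n → EuclideanSpace ℝ (Fin 3)), AxisGeneric x →
          ∀ θ : ℝ, S n (fun i => rot θ (x i)) = S n x) :
    LimitRotationInvariance :=
  limitRotationInvariance_iff_rot_axisGeneric.2 h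

/-! ### What is open, exactly: interacting limits, even levels `n ≥ 4`, axis-generic configurations,
one lattice axis -/

/-- **The open core of the milestone.** `LimitRotationInvariance` is equivalent to: for every
normalised, non-degenerate, translation-invariant, scale-covariant pointwise limit `S` of
`criticalCorr 3` WITH `HasNontrivialU4 S`, at every EVEN level `n ≥ 4` and every AXIS-GENERIC
configuration `x`, `S n (rot θ ∘ x) = S n x` for all real `θ`.  (Gaussian limits, the levels `n ≤ 2`,
the odd levels and coincident configurations by `limitRotationInvariance_iff_hasNontrivialU4_even_four_le`;
the other rotations and the non-generic configurations by `rotInvAt_of_rot_axisGeneric`.)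
[cite: DuminilCopinICM2022, §8.1] -/
theorem limitRotationInvariance_iff_core :
    LimitRotationInvariance ↔
      ∀ (ρ : ℝ → ℝ) (Δ : ℝ) (S : CorrFamily 3), (∀ δ ∈ Set.Ioc (0:ℝ) 1, 0 < ρ δ) →
        HasPointwiseScalingLimit (criticalCorr 3) ρ S →
        (∀ n z, z ∉ NonCoincident 3 n → S n z = 0) → IsNondegenerateTwoPoint S →
        IsTranslationInvariant S → IsScaleCovariant Δ S → HasNontrivialU4 S →
        ∀ n : ℕ, Even n → 4 ≤ n →
          ∀ x : Fin n → EuclideanSpace ℝ (Fin 3), AxisGeneric x →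
            ∀ θ : ℝ, S n (fun i => rot θ (x i)) = S n x := by
  constructor
  · intro h ρ Δ S hρ hlim hnorm hnd htr hsc _ n _ _ x _ θ
    exact h ρ Δ S hρ hlim hnorm hnd htr hsc n (rot θ) x
  · intro h
    refine limitRotationInvariance_iff_hasNontrivialU4_even_four_le.2
      fun ρ Δ S hρ hlim hnorm hnd htr hsc hG n hev h4 R x _ => ?_
    exact rotInvAt_of_rot_axisGeneric hρ hlim hnorm hnd htr hsc n
      (fun y hy θ => h ρ Δ S hρ hlim hnorm hnd htr hsc hG n hev h4 y hy θ) R x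

/-- Hence the milestone follows from its open core: `e₂`-rotation invariance of the interacting
limits at even levels `n ≥ 4` and axis-generic configurations. [cite: DuminilCopinICM2022, §8.1] -/
theorem limitRotationInvariance_of_core
    (h : ∀ (ρ : ℝ → ℝ) (Δ : ℝ) (S : CorrFamily 3), (∀ δ ∈ Set.Ioc (0:ℝ) 1, 0 < ρ δ) →
        HasPointwiseScalingLimit (criticalCorr 3) ρ S →
        (∀ n z, z ∉ NonCoincident 3 n → S n z = 0) → IsNondegenerateTwoPoint S →
        IsTranslationInvariant S → IsScaleCovariant Δ S → HasNontrivialU4 S →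
        ∀ n : ℕ, Even n → 4 ≤ n →
          ∀ x : Fin n → EuclideanSpace ℝ (Fin 3), AxisGeneric x →
            ∀ θ : ℝ, S n (fun i => rot θ (x i)) = S n x) :
    LimitRotationInvariance :=
  limitRotationInvariance_iff_core.2 h

end Summit.CriticalPhenomena.Ising3DConformalLimit.ModularBoostsRotation

end
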